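import Summits.QuantumFields.YangMills.Theorems.BalabanLadderNTSharpPlaquetteMoments
import Summits.QuantumFields.YangMills.Theorems.BalabanLadderNTCouplingSumRuleSkewSign
import HarnessLib

/-!
# Crux `NT` (stmt-QuantumFields-19353): the zero-momentum sum rules on COUPLING OCTAVES — the exact perturbative powers
# `β⁻²` (two-point, both sides) and `−β⁻³` (three-point sign) on windows `[β, Bβ]`, NO logarithm, uniformly in the volume

Fleet lead prover of crux `NT` (unit `ym-spine-19353-p1`, g28), `--supports` helper; sequel of
`Theorems/BalabanLadderNTSharpPlaquetteMoments` (the log-free one-point ceiling `6N − E_{T,β}[A_x] ≤ 6K/β`).  The g8/g9 sum-rule family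
(`CouplingSumRuleBudget`, `CouplingSumRuleFloor`, `CouplingSumRuleSkewSign`) feeds the exact identities
`χ_L(γ; x) := Σ_z Cov_{T,γ}(A_x, A_z) = ∂_γ E_{T,γ}[A_x]` and `ψ_L := Σ_{y,z} torusK3 = ∂_γ χ_L` with the chessboard ceiling, so its
windows are `[β, Bβ(1 + log β)]` and its rates `β⁻²(1 + log β)^{±1}`, `β⁻³(1 + log β)^{−2}`.  With the sharp ceiling every
logarithm disappears and the windows become OCTAVES:

* `exists_sum_torusCov_dens_le_octave` — some `γ ∈ [β, 2β]` has `χ_L(γ; x) ≤ 6K/β²` (all `L ≥ 1`, `β ≥ 4`);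
* `exists_integral_sum_torusCov_dens_ge_sharp` — `∫_β^{Mβ} χ_L(γ; x) dγ ≥ c/β` (odd tori `2L+1 ≥ 5`, `β ≥ β₀`; `M ≥ 1`);
* **`exists_sum_torusCov_dens_ge_octave`** — some `γ ∈ [β, Mβ]` has `χ_L(γ; x) ≥ c/β²`: together with the first item, the zero-momentum
  susceptibility of `tr F²` is EXACTLY of order `β⁻²` on a set of couplings meeting every window `[β, Mβ]`, uniformly in `L`;
* **`exists_sum_sum_torusK3_le_octave`** — some `γ ∈ [β, Bβ]` has `Σ_{y,z} torusK3_{γ,L}(x, y, z) ≤ −c₃/β³`: the zero-momentum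
  three-point function of the action density is NEGATIVE with the exact perturbative power (PT: `ψ ≈ ∂_β(3D/(2β²)) = −3D/β³`);
* `_of_simple` versions for compact simple `G` (no dimension hypothesis).

HONEST FRAMING.  `k = 0` statements on octave-dense couplings (no pointwise-in-β claim: bulk transitions), perturbatively visible;
NT's clauses live at lattice momenta `|k| ≍ a(β) → 0` — nothing of NT's β-uniform floors, the seam or the gap.  NT is NOT proved; the
Yang–Mills mass gap is NOT proved; not Clay.  Refs: Montvay–Münster 1994 §3.2; S. Chatterjee, JFA 271 (2016) [arXiv160201222].
-/

set_option autoImplicit false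

noncomputable section

open MeasureTheory Filter Set
open scoped BigOperators
open Literature.MathematicalPhysics.QuantumLattice
open Literature.MathematicalPhysics.QuantumFieldTheory hiding ZdEdge
open Literature.Probability.LatticeModels (box)
open Summit.QuantumFields.YangMills.Theorems.FreeEnergyLogCoefficient (dimE)
open Summit.QuantumFields.YangMills.Cruxes.OSLegsFromFemtoAndGap.DlrCollarTransfer (torusE dens torusK3)
open Summit.QuantumFields.YangMills.Cruxes.NT.CouplingSumRule (integral_sum_torusCov_dens_eq continuous_sum_torusCov_dens
  sum_torusCov_dens_nonneg torusE_dens_le)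
open Summit.QuantumFields.YangMills.Cruxes.NT.LinkEquipartition (exists_six_mul_sub_torusE_dens_ge integral_sum_sum_torusK3_eq
  continuous_sum_sum_torusK3 dimE_pos_of_isCompactSimpleLieGroup)

namespace Summit.QuantumFields.YangMills.Cruxes.NT.SharpCeilings

section Octaves

variable (G : Type) [Group G] [TopologicalSpace G] [IsTopologicalGroup G] [CompactSpace G]
  [MeasurableSpace G] [BorelSpace G] (r : LatticeRep G)

/-- **The `β⁻²` ceiling at zero momentum on every coupling OCTAVE, uniformly in the volume**: there is `K ≥ 0` with: for every
`L ≥ 1`, `β ≥ 4` and `x` some `γ ∈ [β, 2β]` has `Σ_z Cov_{T,γ}(A_x, A_z) ≤ 6K/β²` (the sum rule `∫_β^{2β} χ_L = E_{2β}[A_x] − E_β[A_x]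
≤ 6N − E_β[A_x] ≤ 6K/β`, and the minimum of the continuous `χ_L` over the octave). [folklore] -/
-- adapted from `CouplingSumRule.exists_sum_torusCov_dens_le_window` (`Theorems/BalabanLadderNTCouplingSumRuleBudget`)
theorem exists_sum_torusCov_dens_le_octave :
    ∃ K : ℝ, 0 ≤ K ∧ ∀ (L : ℕ), 1 ≤ L → ∀ β : ℝ, 4 ≤ β → ∀ x : Fin 4 → ℤ, ∃ γ ∈ Set.Icc β (2 * β),
      ∑ z ∈ box 4 L, (torusE G r γ L (fun U => dens G r x U * dens G r z U) -
          torusE G r γ L (dens G r x) * torusE G r γ L (dens G r z)) ≤ 6 * K / β ^ 2 := by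
  obtain ⟨K, hK0, hK⟩ := exists_six_mul_sub_torusE_dens_le_sharp G r
  refine ⟨K, hK0, fun L hL β hβ x => ?_⟩
  set χ : ℝ → ℝ := fun γ => ∑ z ∈ box 4 L, (torusE G r γ L (fun U => dens G r x U * dens G r z U) -
      torusE G r γ L (dens G r x) * torusE G r γ L (dens G r z)) with hχ
  have hβ0 : 0 < β := by linarith
  have hle : β ≤ 2 * β := by linarith
  have hcont : Continuous χ := continuous_sum_torusCov_dens G r L x
  obtain ⟨γ₀, hγ₀, hmin⟩ := isCompact_Icc.exists_isMinOn (Set.nonempty_Icc.2 hle) hcont.continuousOn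
  refine ⟨γ₀, hγ₀, ?_⟩
  -- the sum rule over the octave
  have hint : ∫ γ in β..(2 * β), χ γ ≤ 6 * K / β := by
    rw [hχ, integral_sum_torusCov_dens_eq]
    have h1 := hK L hL β hβ x
    have h2 := torusE_dens_le G r (2 * β) L x
    linarith
  have hmono : ∫ _γ in β..(2 * β), χ γ₀ ≤ ∫ γ in β..(2 * β), χ γ :=
    intervalIntegral.integral_mono_on hle intervalIntegrable_const (hcont.intervalIntegrable _ _)
      fun γ hγ => hmin hγ
  rw [intervalIntegral.integral_const, smul_eq_mul] at hmono
  have hlen : 2 * β - β = β := by ring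
  rw [hlen] at hmono
  have hchi : χ γ₀ ≤ 6 * K / β / β := by
    rw [le_div_iff₀ hβ0]
    calc χ γ₀ * β = β * χ γ₀ := mul_comm _ _
      _ ≤ _ := hmono.trans hint
  calc χ γ₀ ≤ 6 * K / β / β := hchi
    _ = 6 * K / β ^ 2 := by rw [div_div, sq]

/-- **The integrated zero-momentum floor on an octave-type window** `[β, Mβ]`: there are `c > 0`, `M ≥ 1`, `β₀ ≥ 1` with
`c/β ≤ ∫_β^{Mβ} Σ_z Cov_{T,γ}(A_x, A_z) dγ` for every odd torus `2L+1 ≥ 5`, `β ≥ β₀`, `x` — g9's equipartition floor at `β` minus the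
SHARP ceiling at `Mβ`. [folklore] -/
-- adapted from `LinkEquipartition.exists_integral_sum_torusCov_dens_ge` (`Theorems/BalabanLadderNTCouplingSumRuleFloor`)
theorem exists_integral_sum_torusCov_dens_ge_sharp (hD : 0 < dimE r.ρ) :
    ∃ c M β₀ : ℝ, 0 < c ∧ 1 ≤ M ∧ 1 ≤ β₀ ∧ ∀ (L : ℕ), 2 ≤ L → ∀ β : ℝ, β₀ ≤ β → ∀ x : Fin 4 → ℤ,
      c / β ≤ ∫ γ in β..(M * β), ∑ z ∈ box 4 L,
        (torusE G r γ L (fun U => dens G r x U * dens G r z U) - torusE G r γ L (dens G r x) * torusE G r γ L (dens G r z)) := by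
  obtain ⟨c₁, β₁, hc₁, hβ₁, hfloor⟩ := exists_six_mul_sub_torusE_dens_ge G r hD
  obtain ⟨K, hK0, hceil⟩ := exists_six_mul_sub_torusE_dens_le_sharp G r
  set M : ℝ := max 1 (12 * K / c₁) with hM
  have hM1 : 1 ≤ M := le_max_left _ _
  have hM0 : 0 < M := lt_of_lt_of_le one_pos hM1
  have hMK : 12 * K / c₁ ≤ M := le_max_right _ _
  refine ⟨c₁ / 2, M, max β₁ 4, by positivity, hM1, le_trans (by norm_num) (le_max_right _ _), fun L hL β hβ x => ?_⟩
  have hββ₁ : β₁ ≤ β := (le_max_left _ _).trans hβ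
  have hβ4 : 4 ≤ β := (le_max_right _ _).trans hβ
  have hβ0 : 0 < β := by linarith
  have hMβ : β ≤ M * β := by nlinarith
  have hMβ4 : 4 ≤ M * β := hβ4.trans hMβ
  rw [integral_sum_torusCov_dens_eq]
  have h1 := hfloor β hββ₁ L hL x
  have h2 := hceil L (by omega) (M * β) hMβ4 x
  -- the ceiling at `Mβ` is at most half the floor at `β`
  have h3 : 6 * K / (M * β) ≤ c₁ / (2 * β) := by
    rw [div_le_div_iff₀ (by positivity) (by positivity)]
    have hK12 : 12 * K ≤ c₁ * M := by
      have := (div_le_iff₀ hc₁).1 hMK; linarith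
    nlinarith
  have h5 : c₁ / 2 / β = c₁ / β - c₁ / (2 * β) := by field_simp; ring
  linarith

/-- **THE ZERO-MOMENTUM TWO-POINT FLOOR ON EVERY COUPLING WINDOW `[β, Mβ]`, exact power `β⁻²`, uniformly in the volume**: there
are `c > 0`, `M ≥ 1`, `β₀ ≥ 1` such that for every odd torus `2L+1 ≥ 5`, every `β ≥ β₀` and every `x` some `γ ∈ [β, Mβ]` has
`c/β² ≤ Σ_z Cov_{T,γ}(A_x, A_z)`. [folklore] -/
theorem exists_sum_torusCov_dens_ge_octave (hD : 0 < dimE r.ρ) :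
    ∃ c M β₀ : ℝ, 0 < c ∧ 1 ≤ M ∧ 1 ≤ β₀ ∧ ∀ (L : ℕ), 2 ≤ L → ∀ β : ℝ, β₀ ≤ β → ∀ x : Fin 4 → ℤ,
      ∃ γ ∈ Set.Icc β (M * β),
        c / β ^ 2 ≤ ∑ z ∈ box 4 L,
          (torusE G r γ L (fun U => dens G r x U * dens G r z U) - torusE G r γ L (dens G r x) * torusE G r γ L (dens G r z)) := by
  obtain ⟨c, M, β₀, hc, hM1, hβ₀1, h⟩ := exists_integral_sum_torusCov_dens_ge_sharp G r hD
  refine ⟨c / M, M, β₀, by positivity, hM1, hβ₀1, fun L hL β hβ x => ?_⟩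
  have hM0 : 0 < M := lt_of_lt_of_le one_pos hM1
  have hβ1 : 1 ≤ β := hβ₀1.trans hβ
  have hβ0 : 0 < β := lt_of_lt_of_le one_pos hβ1
  have hMβ : β ≤ M * β := by nlinarith
  set χ : ℝ → ℝ := fun γ => ∑ z ∈ box 4 L,
    (torusE G r γ L (fun U => dens G r x U * dens G r z U) - torusE G r γ L (dens G r x) * torusE G r γ L (dens G r z)) with hχ
  have hcont : Continuous χ := continuous_sum_torusCov_dens G r L x
  obtain ⟨γ₀, hγ₀, hmax⟩ := isCompact_Icc.exists_isMaxOn (Set.nonempty_Icc.2 hMβ) hcont.continuousOn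
  refine ⟨γ₀, hγ₀, ?_⟩
  have hint := h L hL β hβ x
  have hle : ∫ γ in β..(M * β), χ γ ≤ (M * β - β) * χ γ₀ := by
    calc ∫ γ in β..(M * β), χ γ ≤ ∫ _γ in β..(M * β), χ γ₀ :=
          intervalIntegral.integral_mono_on hMβ (hcont.intervalIntegrable _ _) (continuous_const.intervalIntegrable _ _)
            fun γ hγ => hmax hγ
      _ = (M * β - β) * χ γ₀ := by rw [intervalIntegral.integral_const, smul_eq_mul]
  have hlen : M * β - β ≤ M * β := by linarith
  have hχ0 : 0 ≤ χ γ₀ := sum_torusCov_dens_nonneg G r γ₀ L x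
  have hkey : c / β ≤ M * β * χ γ₀ := hint.trans (hle.trans (mul_le_mul_of_nonneg_right hlen hχ0))
  have hMβ0 : 0 < M * β := by positivity
  calc c / M / β ^ 2 = c / β / (M * β) := by field_simp
    _ ≤ M * β * χ γ₀ / (M * β) := div_le_div_of_nonneg_right hkey hMβ0.le
    _ = χ γ₀ := by field_simp

/-- **THE SIGN OF THE ZERO-MOMENTUM THREE-POINT FUNCTION ON EVERY COUPLING WINDOW `[β, Bβ]`, exact power `β⁻³`**: there are
`c₃ > 0`, `B ≥ 1`, `β₀ ≥ 1` such that for every odd torus `2L+1 ≥ 5`, every `β ≥ β₀` and every site `x` some `γ ∈ [β, Bβ]` has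
`Σ_{y,z ∈ box L} torusK3_{γ,L}(x, y, z) ≤ −c₃/β³` (floor point `γ_f ∈ [β, Mβ]` with `χ_L ≥ F = c/β²`, ceiling point `γ_c ∈ [Nβ, 2Nβ]`
with `χ_L ≤ F/2`, FTC `∫_{γ_f}^{γ_c} ψ_L = χ_L(γ_c) − χ_L(γ_f) ≤ −F/2` over a length `≤ 2Nβ`). [folklore] -/
-- adapted from `LinkEquipartition.exists_sum_sum_torusK3_le_window` (`Theorems/BalabanLadderNTCouplingSumRuleSkewSign`)
theorem exists_sum_sum_torusK3_le_octave (hD : 0 < dimE r.ρ) :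
    ∃ c₃ B β₀ : ℝ, 0 < c₃ ∧ 1 ≤ B ∧ 1 ≤ β₀ ∧ ∀ (L : ℕ), 2 ≤ L → ∀ β : ℝ, β₀ ≤ β → ∀ x : Fin 4 → ℤ,
      ∃ γ ∈ Set.Icc β (B * β), ∑ y ∈ box 4 L, ∑ z ∈ box 4 L, torusK3 G r γ L x y z ≤ -(c₃ / β ^ 3) := by
  obtain ⟨c', M, β₀, hc', hM1, hβ₀1, hfl⟩ := exists_sum_torusCov_dens_ge_octave G r hD
  obtain ⟨K, hK0, hceil⟩ := exists_sum_torusCov_dens_le_octave G r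
  -- the far end of the window
  set N : ℝ := max M (12 * K / c') with hN
  have hNM : M ≤ N := le_max_left _ _
  have hNK : 12 * K / c' ≤ N := le_max_right _ _
  have hN1 : 1 ≤ N := hM1.trans hNM
  have hN0 : 0 < N := lt_of_lt_of_le one_pos hN1
  refine ⟨c' / (4 * N), 2 * N, max β₀ 4, by positivity, by linarith, le_trans hβ₀1 (le_max_left _ _),
    fun L hL β hβ x => ?_⟩
  have hββ₀ : β₀ ≤ β := (le_max_left _ _).trans hβ
  have hβ4 : 4 ≤ β := (le_max_right _ _).trans hβ
  have hβ0 : 0 < β := by linarith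
  set χ : ℝ → ℝ := fun γ => ∑ z ∈ box 4 L,
    (torusE G r γ L (fun U => dens G r x U * dens G r z U) - torusE G r γ L (dens G r x) * torusE G r γ L (dens G r z)) with hχ
  set ψ : ℝ → ℝ := fun γ => ∑ y ∈ box 4 L, ∑ z ∈ box 4 L, torusK3 G r γ L x y z with hψ
  set F : ℝ := c' / β ^ 2 with hF
  have hFpos : 0 < F := by positivity
  -- the floor point
  obtain ⟨γf, hγf, hfloor⟩ := hfl L hL β hββ₀ x
  -- the ceiling point in the octave `[β', 2β']`, `β' = Nβ`
  set β' : ℝ := N * β with hβ'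
  have hβ'ge : M * β ≤ β' := by rw [hβ']; exact mul_le_mul_of_nonneg_right hNM hβ0.le
  have hββ' : β ≤ β' := by nlinarith
  have hβ'4 : 4 ≤ β' := hβ4.trans hββ'
  have hβ'0 : 0 < β' := by linarith
  obtain ⟨γc, hγc, hceilc⟩ := hceil L (by omega) β' hβ'4 x
  -- the ceiling value is at most `F/2`: `6K/(Nβ)² ≤ 6K/(Nβ²) ≤ c'/(2β²)`
  have hU : 6 * K / β' ^ 2 ≤ F / 2 := by
    have hK12 : 12 * K ≤ c' * N := by
      have := (div_le_iff₀ hc').1 hNK; linarith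
    rw [hF, hβ', div_le_iff₀ (by positivity : (0 : ℝ) < (N * β) ^ 2)]
    have hN2 : N ≤ N ^ 2 := by nlinarith
    have e : c' / β ^ 2 / 2 * (N * β) ^ 2 = c' * N ^ 2 / 2 := by field_simp
    rw [e]
    nlinarith
  have hle_c : χ γc ≤ F / 2 := le_trans hceilc hU
  have hge_f : F ≤ χ γf := hfloor
  -- order of the two points
  have hfc : γf < γc := by
    have hle : γf ≤ γc := hγf.2.trans (hβ'ge.trans hγc.1)
    rcases hle.eq_or_lt with h | h
    · exfalso; rw [h] at hge_f; linarith
    · exact h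
  -- FTC between them and the minimum of `ψ`
  have hint : ∫ γ in γf..γc, ψ γ = χ γc - χ γf := integral_sum_sum_torusK3_eq G r L x γf γc
  have hψc : Continuous ψ := continuous_sum_sum_torusK3 G r L x
  obtain ⟨γm, hγm, hmin⟩ := isCompact_Icc.exists_isMinOn (Set.nonempty_Icc.2 hfc.le) hψc.continuousOn
  have hlow : (γc - γf) * ψ γm ≤ ∫ γ in γf..γc, ψ γ := by
    calc (γc - γf) * ψ γm = ∫ _γ in γf..γc, ψ γm := by rw [intervalIntegral.integral_const, smul_eq_mul]
      _ ≤ ∫ γ in γf..γc, ψ γ :=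
          intervalIntegral.integral_mono_on hfc.le (continuous_const.intervalIntegrable _ _) (hψc.intervalIntegrable _ _)
            fun γ hγ => hmin hγ
  have hneg : (γc - γf) * ψ γm ≤ -(F / 2) := by linarith
  have hlen0 : 0 < γc - γf := by linarith
  have hlen : γc - γf ≤ 2 * β' := by linarith [hγc.2, hγf.1]
  refine ⟨γm, ⟨hγf.1.trans hγm.1, hγm.2.trans (hγc.2.trans (by rw [hβ']; ring_nf; exact le_rfl))⟩, ?_⟩
  have h1 : ψ γm ≤ -(F / 2) / (γc - γf) := by rwa [le_div_iff₀ hlen0, mul_comm]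
  have h2 : -(F / 2) / (γc - γf) ≤ -(F / 2) / (2 * β') := by
    rw [neg_div, neg_div, neg_le_neg_iff]
    exact div_le_div_of_nonneg_left (by positivity) hlen0 hlen
  have h3 : -(F / 2) / (2 * β') = -(c' / (4 * N) / β ^ 3) := by
    rw [hF, hβ']; field_simp; ring
  linarith [h1, h2, h3.le, h3.ge]

/-- **Compact simple gauge groups: the zero-momentum two-point floor on every window `[β, Mβ]`** (no dimension hypothesis).
[folklore] -/
theorem exists_sum_torusCov_dens_ge_octave_of_simple (hG : IsCompactSimpleLieGroup G) :
    ∃ c M β₀ : ℝ, 0 < c ∧ 1 ≤ M ∧ 1 ≤ β₀ ∧ ∀ (L : ℕ), 2 ≤ L → ∀ β : ℝ, β₀ ≤ β → ∀ x : Fin 4 → ℤ,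
      ∃ γ ∈ Set.Icc β (M * β),
        c / β ^ 2 ≤ ∑ z ∈ box 4 L,
          (torusE G r γ L (fun U => dens G r x U * dens G r z U) - torusE G r γ L (dens G r x) * torusE G r γ L (dens G r z)) :=
  exists_sum_torusCov_dens_ge_octave G r (dimE_pos_of_isCompactSimpleLieGroup G r hG)

/-- **Compact simple gauge groups: the sign of the zero-momentum three-point function on every window `[β, Bβ]`** (no
dimension hypothesis). [folklore] -/
theorem exists_sum_sum_torusK3_le_octave_of_simple (hG : IsCompactSimpleLieGroup G) :
    ∃ c₃ B β₀ : ℝ, 0 < c₃ ∧ 1 ≤ B ∧ 1 ≤ β₀ ∧ ∀ (L : ℕ), 2 ≤ L → ∀ β : ℝ, β₀ ≤ β → ∀ x : Fin 4 → ℤ,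
      ∃ γ ∈ Set.Icc β (B * β), ∑ y ∈ box 4 L, ∑ z ∈ box 4 L, torusK3 G r γ L x y z ≤ -(c₃ / β ^ 3) :=
  exists_sum_sum_torusK3_le_octave G r (dimE_pos_of_isCompactSimpleLieGroup G r hG)

end Octaves

end Summit.QuantumFields.YangMills.Cruxes.NT.SharpCeilings

end
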